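import Literature.AlgebraicGeometry.Smoothening.DefectBound
import Literature.AlgebraicGeometry.Smoothening.NeronDefectDVR
import Mathlib.RingTheory.TensorProduct.Quotient
import Mathlib.RingTheory.Artinian.Module
import Mathlib.Data.Real.ENatENNReal
import Mathlib.Data.ENNReal.Inv
import HarnessLib

/-!
# Néron's measure at ramified points: `δ(a) ≤ c · e(a)` and the normalised defect `δ(a)/e(a)`

Topic: `Literature/AlgebraicGeometry/Smoothening`; sequel of `DefectBound.lean` (BLR 3.3/3: Néron's
measure for the defect of smoothness `δ` is bounded on the points of `X = Spec A` with values in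
discrete valuation rings `S` over `R` in which the parameter `ϖ ∈ R` stays a uniformizer, i.e. of
ramification index one) and of `NeronDefectDVR.lean` (`δ` multiplies by `length(S''/𝔪_S S'')`
under a flat local base change `S → S''` of the point ring, `neronDefect_baseChange`).

For the points used by arc-space arguments — `S = k'⟦s⟧` mapping `ϖ` to an element of
`s`-order `e ≥ 1` (a *ramified* point, `e = e(a)` its ramification number) — `δ` itself is not
bounded (it is multiplied by `m` under the reparametrisation `s = s'^m`), but the **normalised
defect** `δ(a)/e(a)` is.  This file PROVES:

* `length_quotient_span_singleton_of_associated`, `length_quotient_span_singleton_eq_addVal` —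
  the ramification number as a length: `e(a) = length_S (S/ϖS) = v_S(ϖ)`;
* `neronDefect_le_mul_of_dvd_pow` — **`δ(a) ≤ e · n · (N - d)`** if `ϖⁿ ∈ Fitt_d(Ω[A⁄R])`,
  `Ω[A⁄R]` has `N` generators, `d = rank_S a*Ω[A⁄R]` and `ϖ ∣ πᵉ` in `S` (`π` a uniformizer of
  `S`): the proof of BLR 3.3/3 in `DefectBound` run with `π^{e n} ∈ Fitt_d(a*Ω)`;
* `neronDefect_eq_zero_of_isUnit` — points of the generic fibre (`ϖ` a unit in `S`) have `δ = 0`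
  when `Ω[A[1/ϖ]⁄R]` is projective (smooth generic fibre);
* `exists_bound_neronDefect_mul_length` — **BLR 3.3/3 for all ramification indices**: if
  `Ω[A[1/ϖ]⁄R]` is free and `Ω[A⁄R]` finitely generated there is `c`, depending only on `X`, with
  `δ(a) ≤ c · length_S (S/ϖS)` for every point `a` of `X` with values in a discrete valuation
  ring `S` over `R` (no condition on `ϖ` in `S`; both sides are `⊤`-free unless `ϖ = 0` in `S`,
  when the right-hand side is `⊤`);
* `length_quotient_span_singleton_baseChange`, `neronDefect_div_length_baseChange` — **the
  normalised defect `δ(a)/e(a) ∈ ℝ≥0∞` is invariant under flat local base change `S → S''` of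
  finite index `length(S''/𝔪_S S'')`** (e.g. `k'⟦s⟧ → k''⟦s'⟧`, `s ↦ unit · s'^m`): numerator and
  denominator are both multiplied by the index (Mathlib `IsLocalRing.length_baseChange`).

[folklore] consequences of the printed statements (BLR 3.3/3 is stated for ramification index
one; Artin (3.8): "`l(x')` … is bounded above for all points `x'` (with `R'` smooth)"); no named
facts are introduced (D-0026).

## References

* S. Bosch, W. Lütkebohmert, M. Raynaud, *Néron Models*, Springer 1990, §3.3, Lemma 3.
  [BLRNeronModels1990] (Not held; number only.)
* M. Artin, *Néron Models*, in G. Cornell, J. H. Silverman (eds.), *Arithmetic Geometry*,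
  Springer 1986, (3.8) (p. 226). [Artin1986NeronModels]
* The Stacks Project, Tag 0BJ6 (the defect `e = Σ eᵢ` in Néron desingularization).
  [StacksProject]
-/

noncomputable section

open scoped TensorProduct ENNReal
open Module Submodule KaehlerDifferential IsLocalRing
open Literature.RingTheory.FittingIdeal

namespace Literature.AlgebraicGeometry.Smoothening

universe u v

/-! ## The ramification number of a point as a length -/

section Length

variable {S : Type u} [CommRing S] [IsDomain S] [IsDiscreteValuationRing S]

/-- Over a discrete valuation ring with uniformizer `π`, `length_S (S/xS) = n` if `x ~ πⁿ`.
[folklore] -/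
theorem length_quotient_span_singleton_of_associated {π : S} (hπ : Irreducible π) {x : S}
    {n : ℕ} (hx : Associated x (π ^ n)) : Module.length S (S ⧸ Ideal.span {x}) = n := by
  rw [Ideal.span_singleton_eq_span_singleton.mpr hx, ← Ideal.span_singleton_pow,
    ← hπ.maximalIdeal_eq]
  exact IsDiscreteValuationRing.length_quotient_pow_maximalIdeal S n

variable (S) in
/-- A discrete valuation ring has infinite length as a module over itself (it is not Artinian,
not being a field). [folklore] -/
theorem length_self_eq_top : Module.length S S = ⊤ := by
  by_contra h
  have hfl := Module.length_ne_top_iff.mp h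
  rw [isFiniteLength_iff_isNoetherian_isArtinian] at hfl
  haveI : IsArtinianRing S := hfl.2
  exact IsDiscreteValuationRing.not_isField S (IsArtinianRing.isField_of_isDomain S)

/-- `length_S (S/0) = ⊤` for a discrete valuation ring `S`. [folklore] -/
theorem length_quotient_span_zero_eq_top :
    Module.length S (S ⧸ Ideal.span {(0 : S)}) = ⊤ := by
  have h0 : Ideal.span {(0 : S)} = ⊥ := Ideal.span_singleton_eq_bot.mpr rfl
  rw [h0, (Submodule.quotEquivOfEqBot (⊥ : Submodule S S) rfl).length_eq]
  exact length_self_eq_top S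

/-- **The ramification number as a length**: `length_S (S/xS) = v_S(x)` for every `x` in a
discrete valuation ring `S` (both sides are `⊤` for `x = 0`). [folklore] -/
theorem length_quotient_span_singleton_eq_addVal (x : S) :
    Module.length S (S ⧸ Ideal.span {x}) = IsDiscreteValuationRing.addVal S x := by
  by_cases hx : x = 0
  · rw [hx, IsDiscreteValuationRing.addVal_zero]
    exact length_quotient_span_zero_eq_top
  obtain ⟨π, hπ⟩ := IsDiscreteValuationRing.exists_irreducible S
  obtain ⟨n, hn⟩ := IsDiscreteValuationRing.associated_pow_irreducible hx hπ
  rw [length_quotient_span_singleton_of_associated hπ hn,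
    (IsDiscreteValuationRing.addVal_eq_iff_associated x (π ^ n)).mpr hn, hπ.addVal_pow]

end Length

/-! ## Lengths of `S''/xS''` under flat local base change -/

section BaseChangeLength

variable {S : Type u} [CommRing S] [IsLocalRing S] {S'' : Type v} [CommRing S''] [IsLocalRing S'']
  [Algebra S S''] [IsLocalHom (algebraMap S S'')] [Module.Flat S S'']

/-- **`length_{S''}(S''/xS'') = length_S(S/xS) · length_{S''}(S''/𝔪_S S'')`** for a flat local
homomorphism of local rings `S → S''` (Mathlib `IsLocalRing.length_baseChange` applied to
`S/xS`, with `S'' ⊗_S S/xS = S''/xS''`). [folklore] -/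
theorem length_quotient_span_singleton_baseChange (x : S) :
    Module.length S'' (S'' ⧸ Ideal.span {algebraMap S S'' x}) =
      Module.length S (S ⧸ Ideal.span {x}) *
        Module.length S'' (S'' ⧸ (maximalIdeal S).map (algebraMap S S'')) := by
  have hmap : (Ideal.span {x}).map (algebraMap S S'') = Ideal.span {algebraMap S S'' x} := by
    rw [Ideal.map_span, Set.image_singleton]
  rw [← hmap, (Algebra.TensorProduct.quotIdealMapEquivTensorQuot S'' (Ideal.span {x})
    ).toLinearEquiv.length_eq, IsLocalRing.length_baseChange]

omit [Module.Flat S S''] in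
/-- The index `length_{S''}(S''/𝔪_S S'')` of a local homomorphism of local rings is non-zero.
[folklore] -/
theorem length_quotient_map_maximalIdeal_ne_zero :
    Module.length S'' (S'' ⧸ (maximalIdeal S).map (algebraMap S S'')) ≠ 0 := by
  have hle : (maximalIdeal S).map (algebraMap S S'') ≤ maximalIdeal S'' :=
    Ideal.map_le_iff_le_comap.mpr fun a ha => map_nonunit (algebraMap S S'') a ha
  have hne : (maximalIdeal S).map (algebraMap S S'') ≠ ⊤ :=
    fun h => (maximalIdeal.isMaximal S'').ne_top (top_le_iff.mp (h ▸ hle))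
  haveI : Nontrivial (S'' ⧸ (maximalIdeal S).map (algebraMap S S'')) :=
    Ideal.Quotient.nontrivial_iff.mpr hne
  exact pos_iff_ne_zero.mp Module.length_pos

end BaseChangeLength

/-! ## `δ(a) ≤ e · n · (N - d)` at a point of ramification number `e` -/

section Ring

variable (R : Type u) [CommRing R] (ϖ : R) (A : Type u) [CommRing A] [Algebra R A]

section Pointwise

variable (S : Type u) [CommRing S] [IsDomain S] [IsDiscreteValuationRing S] [Algebra R S]
  [Algebra A S] [IsScalarTower R A S]

/-- **`δ(a) ≤ e · n · (N - d)` at a ramified point**: if `ϖⁿ ∈ Fitt_d(Ω[A⁄R])`, `Ω[A⁄R]` is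
generated by `N` elements, the point `a : A → S` (a discrete valuation ring with uniformizer `π`)
has `rank_S a*Ω[A⁄R] = d`, and `ϖ ∣ πᵉ` in `S` (i.e. `v_S(ϖ) ≤ e`), then `δ(a) ≤ e n (N - d)`:
`π^{e n} ∈ Fitt_d(a*Ω[A⁄R])`, and `DefectBound.length_torsion_le_of_pow_mem_fittingIdeal`
applies. For `e = 1` this is `neronDefect_le_of_pow_mem_fittingIdeal` (BLR 3.3/3). [folklore] -/
theorem neronDefect_le_mul_of_dvd_pow {π : S} (hπ : Irreducible π) {e d n N : ℕ}
    (hdiv : algebraMap R S ϖ ∣ π ^ e)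
    (hfit : algebraMap R A ϖ ^ n ∈ Module.fittingIdeal A Ω[A⁄R] d)
    (hd : finrank S (S ⊗[A] Ω[A⁄R]) = d) (ω : Fin N → Ω[A⁄R])
    (hω : span A (Set.range ω) = ⊤) : neronDefect R A S ≤ (e * n * (N - d) : ℕ) := by
  haveI : Module.Finite A Ω[A⁄R] :=
    ⟨Submodule.fg_def.mpr ⟨Set.range ω, Set.finite_range ω, hω⟩⟩
  -- `ϖⁿ ∈ Fitt_d(S ⊗ Ω)`
  have h1 : algebraMap R S ϖ ^ n ∈ Module.fittingIdeal S (S ⊗[A] Ω[A⁄R]) d := by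
    have := Module.map_fittingIdeal_le_baseChange (R := A) (M := Ω[A⁄R]) S d
      (Ideal.mem_map_of_mem (algebraMap A S) hfit)
    rwa [map_pow, ← IsScalarTower.algebraMap_apply] at this
  -- hence `π^{e n} ∈ Fitt_d(S ⊗ Ω)`
  have h1' : π ^ (e * n) ∈ Module.fittingIdeal S (S ⊗[A] Ω[A⁄R]) d := by
    obtain ⟨c, hc⟩ := pow_dvd_pow_of_dvd hdiv n
    rw [pow_mul, hc]
    exact Ideal.mul_mem_right _ _ h1
  -- the generators `1 ⊗ ωᵢ`
  have h2 : span S (Set.range fun i => (1 : S) ⊗ₜ[A] ω i) = ⊤ := by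
    have h := Submodule.baseChange_span (R := A) (M := Ω[A⁄R]) (A := S) (Set.range ω)
    rw [hω, Submodule.baseChange_top] at h
    have hr : Set.range (fun i => (1 : S) ⊗ₜ[A] ω i) =
        TensorProduct.mk A S Ω[A⁄R] 1 '' Set.range ω := by
      ext z
      simp only [Set.mem_range, Set.mem_image, TensorProduct.mk_apply, exists_exists_eq_and]
    rw [hr]
    exact h.symm
  exact length_torsion_le_of_pow_mem_fittingIdeal (S ⊗[A] Ω[A⁄R]) hπ hd h1' _ h2

end Pointwise

variable (A' : Type u) [CommRing A'] [Algebra A A'] [Algebra R A'] [IsScalarTower R A A']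
  [IsLocalization.Away (algebraMap R A ϖ) A']

/-- **Points of the generic fibre have `δ = 0`** (when the generic fibre `Spec A[1/ϖ]` has
projective `Ω¹`, e.g. is smooth): if `ϖ` is a unit in `S` the point factors through `A[1/ϖ]`,
and `δ` only depends on the local ring at the point. [folklore] -/
theorem neronDefect_eq_zero_of_isUnit [Module.Projective A' Ω[A'⁄R]] (S : Type u) [CommRing S]
    [IsDomain S] [Algebra R S] [Algebra A S] [IsScalarTower R A S]
    (hu : IsUnit (algebraMap R S ϖ)) : neronDefect R A S = 0 := by
  have hu' : IsUnit (algebraMap A S (algebraMap R A ϖ)) := by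
    rwa [← IsScalarTower.algebraMap_apply]
  letI : Algebra A' S := (IsLocalization.Away.lift (algebraMap R A ϖ) hu' : A' →+* S).toAlgebra
  haveI : IsScalarTower A A' S := IsScalarTower.of_algebraMap_eq fun a =>
    (IsLocalization.Away.lift_eq (S := A') (algebraMap R A ϖ) hu' a).symm
  rw [neronDefect_eq_of_isLocalization R A A' (Submonoid.powers (algebraMap R A ϖ)) S]
  exact neronDefect_eq_zero_of_projective R A' S

/-- **BLR 3.3/3 at points of arbitrary ramification — `δ(a) ≤ c · e(a)`**: if `Ω[A[1/ϖ]⁄R]` is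
free (of rank `d`; e.g. the generic fibre of `X = Spec A` is smooth, after shrinking) and
`Ω[A⁄R]` is finitely generated, there is `c`, depending only on `X`, such that
`δ(a) ≤ c · length_S (S/ϖS)` for every point `a` of `X` with values in a discrete valuation ring
`S` over `R`; here `length_S (S/ϖS) = v_S(ϖ)` (`length_quotient_span_singleton_eq_addVal`) is the
ramification number `e(a)` of the point (`⊤` if `ϖ = 0` in `S`, `0` if the point lies in the
generic fibre, where `δ(a) = 0`). For `e(a) = 1` this is `exists_bound_neronDefect`. [folklore] -/
theorem exists_bound_neronDefect_mul_length [Module.Finite A Ω[A⁄R]] [Module.Free A' Ω[A'⁄R]] :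
    ∃ c : ℕ, ∀ (S : Type u) [CommRing S] [IsDomain S] [IsDiscreteValuationRing S] [Algebra R S]
      [Algebra A S] [IsScalarTower R A S],
        neronDefect R A S ≤ c * Module.length S (S ⧸ Ideal.span {algebraMap R S ϖ}) := by
  -- if `ϖ = 0` in `S` the right-hand side is `⊤` as soon as `c ≠ 0`
  have htop : ∀ (c : ℕ), c ≠ 0 → ∀ (S : Type u) [CommRing S] [IsDomain S]
      [IsDiscreteValuationRing S] [Algebra R S] [Algebra A S],
      algebraMap R S ϖ = 0 →
        neronDefect R A S ≤ c * Module.length S (S ⧸ Ideal.span {algebraMap R S ϖ}) := by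
    intro c hc S _ _ _ _ _ h0
    rw [h0, length_quotient_span_zero_eq_top, ENat.mul_top (Nat.cast_ne_zero.mpr hc)]
    exact le_top
  rcases subsingleton_or_nontrivial A' with hA' | hA'
  · -- `A[1/ϖ] = 0`: `ϖ` is nilpotent in `A`, hence `ϖ = 0` in every domain `S` over `A`
    obtain ⟨⟨m, hm⟩, hm0⟩ :=
      (IsLocalization.map_eq_zero_iff (Submonoid.powers (algebraMap R A ϖ)) A' (1 : A)).mp
        (Subsingleton.elim _ _)
    obtain ⟨n, rfl⟩ := (Submonoid.mem_powers_iff _ _).mp hm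
    simp only [mul_one] at hm0
    refine ⟨1, fun S _ _ _ _ _ _ => htop 1 one_ne_zero S ?_⟩
    refine IsNilpotent.eq_zero ⟨n, ?_⟩
    rw [IsScalarTower.algebraMap_apply R A S, ← map_pow, hm0, map_zero]
  haveI : Module.Finite A' Ω[A'⁄R] := by
    haveI : IsLocalizedModule (Submonoid.powers (algebraMap R A ϖ))
        (KaehlerDifferential.map R R A A') := inferInstance
    exact Module.Finite.of_isLocalizedModule (Submonoid.powers (algebraMap R A ϖ))
      (KaehlerDifferential.map R R A A')
  obtain ⟨n, hn⟩ := exists_pow_mem_fittingIdeal_of_isLocalization R ϖ A A'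
    (fittingIdeal_eq_top_of_free R A')
  obtain ⟨N, ω, hω⟩ := Module.Finite.exists_fin (R := A) (M := Ω[A⁄R])
  refine ⟨max 1 (n * (N - finrank A' Ω[A'⁄R])), fun S _ _ _ _ _ _ => ?_⟩
  by_cases h0 : algebraMap R S ϖ = 0
  · exact htop _ (Nat.pos_iff_ne_zero.mp (lt_max_of_lt_left one_pos)) S h0
  by_cases hu : IsUnit (algebraMap R S ϖ)
  · rw [neronDefect_eq_zero_of_isUnit R ϖ A A' S hu]
    exact zero_le
  obtain ⟨π, hπ⟩ := IsDiscreteValuationRing.exists_irreducible S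
  obtain ⟨e, he⟩ := IsDiscreteValuationRing.associated_pow_irreducible h0 hπ
  have hδ := neronDefect_le_mul_of_dvd_pow R ϖ A S hπ he.dvd hn
    (finrank_tensor_kaehler_eq_of_free_localization R ϖ A S A' h0) ω hω
  rw [length_quotient_span_singleton_of_associated hπ he]
  calc neronDefect R A S ≤ (e * n * (N - finrank A' Ω[A'⁄R]) : ℕ) := hδ
    _ = ((n * (N - finrank A' Ω[A'⁄R]) : ℕ) : ℕ∞) * (e : ℕ∞) := by push_cast; ring
    _ ≤ ((max 1 (n * (N - finrank A' Ω[A'⁄R])) : ℕ) : ℕ∞) * (e : ℕ∞) := by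
        gcongr
        exact le_max_right _ _

end Ring

/-! ## The normalised defect `δ(a)/e(a)` under base change of the point ring -/

section Normalised

variable (R : Type u) [CommRing R] (A : Type u) [CommRing A] [Algebra R A]
  (S : Type u) [CommRing S] [IsDomain S] [IsPrincipalIdealRing S] [IsLocalRing S]
  (S'' : Type u) [CommRing S''] [IsDomain S''] [IsLocalRing S''] [Algebra S S'']
  [IsLocalHom (algebraMap S S'')] [Module.Flat S S'']
  [Algebra A S] [Algebra A S''] [IsScalarTower A S S'']
  [Algebra R S] [Algebra R S''] [IsScalarTower R S S'']

/-- **The normalised defect is invariant under base change of the point ring**: for a flat local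
homomorphism `S → S''` of local domains (`S` principal, `S` injecting into `S''`) of finite index
`length_{S''}(S''/𝔪_S S'') < ⊤` — e.g. a finite extension of discrete valuation rings, or the
reparametrisation `k'⟦s⟧ → k''⟦s'⟧`, `s ↦ unit · s'^m` — and the composite point
`a'' : A → S → S''`, one has `δ(a'')/e(a'') = δ(a)/e(a)` in `ℝ≥0∞`, where
`e(·) = length (·/t·)` is the ramification number with respect to a parameter `t ∈ R`: both
`δ` (`neronDefect_baseChange`) and `e` (`length_quotient_span_singleton_baseChange`) get
multiplied by the index. [folklore] -/
theorem neronDefect_div_length_baseChange [Module.Finite A Ω[A⁄R]]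
    (hinj : Function.Injective (algebraMap S S''))
    (hn : Module.length S'' (S'' ⧸ (maximalIdeal S).map (algebraMap S S'')) ≠ ⊤) (t : R) :
    ((neronDefect R A S'' : ℕ∞) : ℝ≥0∞) /
        ((Module.length S'' (S'' ⧸ Ideal.span {algebraMap R S'' t}) : ℕ∞) : ℝ≥0∞) =
      ((neronDefect R A S : ℕ∞) : ℝ≥0∞) /
        ((Module.length S (S ⧸ Ideal.span {algebraMap R S t}) : ℕ∞) : ℝ≥0∞) := by
  have hδ := neronDefect_baseChange R A S S'' hinj
  have he : Module.length S'' (S'' ⧸ Ideal.span {algebraMap R S'' t}) =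
      Module.length S (S ⧸ Ideal.span {algebraMap R S t}) *
        Module.length S'' (S'' ⧸ (maximalIdeal S).map (algebraMap S S'')) := by
    rw [IsScalarTower.algebraMap_apply R S S'' t]
    exact length_quotient_span_singleton_baseChange (algebraMap R S t)
  have hn0 := length_quotient_map_maximalIdeal_ne_zero (S := S) (S'' := S'')
  rw [hδ, he]
  push_cast
  exact ENNReal.mul_div_mul_right _ _ (by exact_mod_cast hn0) (by exact_mod_cast hn)

end Normalised

end Literature.AlgebraicGeometry.Smoothening

end
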